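import Literature.Probability.Percolation.InterfaceTraversalBound
import Literature.Probability.Percolation.CLE6Proofs
import Literature.Probability.Percolation.TriLoopWinding
import Literature.Probability.Percolation.TriDiscInterface
import HarnessLib

/-!
# The hexagonal exploration polygon at mesh `δ`: darts, side segments, stretches

Topic: Probability / Percolation (the triangular twin of `ExplorationPolygon.lean` and of Part I
of `InterfaceTraversalBound.lean`; deterministic planar input of the multiple-crossing estimate
for the site-percolation exploration path, Aizenman–Burchard, Duke Math. J. 99 (1999),
Appendix A). For an exploration path `w` of the hexagonal lattice in a discrete Dobrushin domain
(`IsExplorationPath`, `LatticeInterface.lean`; faces `w.getVert i`, `i ≤ w.length`) we fix, for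
every step `i < w.length`, the crossed dart `lv i → rv i` of `𝕋` (left site `lv i`, open under
the boundary condition; right site `rv i`, closed) and its **side index** `sideIdx i : Fin 3`,
under which the step reads `w.getVert (i+1) = oppFace (w.getVert i) (sideIdx i)`,
`rv i = faceVertex (w.getVert i) (sideIdx i + 1)`, `lv i = faceVertex (w.getVert i) (sideIdx i + 2)`
(the anticlockwise labelling of `TriDiscreteDomain.lean`). At mesh `δ` we define the polygon
vertices `polyPt δ w i = δ · hexCenter (w.getVert i)`, the **dart pieces**
`polyPiece δ w i = [polyPt i, polyPt (i+1)]` (edges of `δH`), their union `polyTrace δ w`, the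
stretches `polySubPath δ w i₀ k` as `Path`s, and the **side points** `leftPt i = δ · lv i`,
`rightPt i = δ · rv i` joined by the **side segment** `sideSeg i` (the crossed edge of `δ𝕋`).

Proved here (lattice geometry of `TriLatticeSegments.lean`, no topology of the domain):
* the polygon of the walk is the polyline through the `polyPt`, its range is `polyTrace`;
* a unit edge of `δ𝕋` (or a lattice point) meets the dart piece `i` only if it is the crossed
  edge `{lv i, rv i}`; hence lattice points are off the trace, only the `m`-th piece meets the
  `m`-th side segment, and it crosses it once transversally (`segSide` signs);
* consecutive left (right) sites are equal or joined by a unit edge off the trace;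
* metric bookkeeping (`dist` of pieces, side points and polygon vertices `≤ δ`).
-/

noncomputable section

open Set Metric Complex
open scoped Pointwise

namespace Literature.Probability.Percolation

open LatticeModels Literature.Topology.PlaneTopology

/-! ### Two lattice lemmas (private copies to keep the import closure small) -/

/-- The left face of a reversed side of a face is the opposite face (copy of
`TriFaceLabel.leftFace_faceVertex_rev`). [folklore] -/
private theorem leftFace_faceVertex_rev' (F : HexVertex) (j : Fin 3) :
    leftFace (faceVertex F (j + 2)) (faceVertex F (j + 1)) = oppFace F j := by
  have e : j + 1 + 1 = j + 2 := by rw [add_assoc]; rfl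
  have h1 : faceVertex F (j + 1) = faceVertex F (j + 2) + triDir (faceDartDir F (j + 1) + 3) := by
    rw [triDir_add_three, ← e, faceVertex_succ F (j + 1)]; abel
  rw [h1, leftFace, dirOf_add_triDir]
  rcases F with ⟨x, t⟩
  by_cases ht : t = 0
  · subst ht
    fin_cases j <;> simp [faceVertex, faceDartDir, leftFaceDir, oppFace]
  · obtain rfl : t = 1 := by
      rcases Fin.exists_fin_two.1 ⟨t, rfl⟩ with h' | h'
      · exact (ht h').elim
      · exact h'
    fin_cases j <;> simp [faceVertex, faceDartDir, leftFaceDir, oppFace, add_sub_assoc, add_assoc]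

/-- **The two faces of a dart of `𝕋`, by the anticlockwise labelling of the right face**: if
`triEdgeFaces ⟨(u, v), h⟩ = (gL, gR)` then, for some side index `J`, `gL = oppFace gR J`,
`v = faceVertex gR (J + 1)` and `u = faceVertex gR (J + 2)` (the right face sees the dart
reversed, clockwise). [folklore] -/
theorem exists_sideIdx_of_triEdgeFaces {u v : Site 2} (h : triGraph.Adj u v) :
    ∃ J : Fin 3, (triEdgeFaces ⟨(u, v), h⟩).1 = oppFace (triEdgeFaces ⟨(u, v), h⟩).2 J ∧
      v = faceVertex (triEdgeFaces ⟨(u, v), h⟩).2 (J + 1) ∧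
      u = faceVertex (triEdgeFaces ⟨(u, v), h⟩).2 (J + 2) := by
  -- the right face is the left face of the reversed dart
  have hR : (triEdgeFaces ⟨(u, v), h⟩).2 = leftFace v u := by
    have hs := triEdgeFaces_symm_holds ⟨(u, v), h⟩
    have : (⟨(u, v), h⟩ : triGraph.Dart).symm = ⟨(v, u), h.symm⟩ := rfl
    rw [this] at hs
    have h2 : (triEdgeFaces ⟨(v, u), h.symm⟩).1 = (triEdgeFaces ⟨(u, v), h⟩).2 := by
      rw [hs]; rfl
    rw [← h2, ← leftFace_eq_triEdgeFaces_fst h.symm]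
  have hL : (triEdgeFaces ⟨(u, v), h⟩).1 = leftFace u v := (leftFace_eq_triEdgeFaces_fst h).symm
  obtain ⟨j, hv, hu⟩ := exists_eq_faceVertex_of_adj h.symm
  rw [← hR] at hv hu
  refine ⟨j + 2, ?_, ?_, ?_⟩
  · rw [hL, ← leftFace_faceVertex_rev' _ (j + 2)]
    have e1 : j + 2 + 2 = j + 1 := by
      rw [add_assoc]; fin_cases j <;> rfl
    have e2 : j + 2 + 1 = j := by
      rw [add_assoc]; fin_cases j <;> rfl
    rw [e1, e2, ← hu, ← hv]
  · have e2 : j + 2 + 1 = j := by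
      rw [add_assoc]; fin_cases j <;> rfl
    rw [e2]; exact hv
  · have e1 : j + 2 + 2 = j + 1 := by
      rw [add_assoc]; fin_cases j <;> rfl
    rw [e1]; exact hu

section IsExplorationPath

variable {Dd : DiscreteDobrushin} {ω : SiteConfig (Site 2)} {f₀ g₀ : HexVertex}
  {w : hexGraph.Walk f₀ g₀}

/-! ### The crossed darts of the steps -/

/-- The `i`-th step of an exploration path is an exploration step. (Smirnov 2001, §2.) [cite: Smirnov2001, §2] -/
theorem _root_.Literature.Probability.LatticeModels.IsExplorationPath.step_getVert
    (hw : IsExplorationPath Dd ω w) {i : ℕ} (hi : i < w.length) :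
    IsExplorationStep Dd ω (w.getVert i) (w.getVert (i + 1)) := by
  have hi' : i < w.darts.length := by rw [SimpleGraph.Walk.length_darts]; exact hi
  have h := hw.step _ (List.getElem_mem hi')
  rw [SimpleGraph.Walk.darts_getElem_eq_getVert i hi'] at h
  exact h

/-- The **left site** of the `i`-th step (open under the boundary condition): the tail of the
crossed dart of `𝕋`, chosen by `Exists.choose` (junk `0` past the end). (Smirnov 2001, §2:
open hexagons on the left of the exploration path.) [cite: Smirnov2001, §2] -/
def _root_.Literature.Probability.LatticeModels.IsExplorationPath.lv
    (hw : IsExplorationPath Dd ω w) (i : ℕ) : Site 2 :=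
  if hi : i < w.length then (hw.step_getVert hi).choose.fst else 0

/-- The **right site** of the `i`-th step (closed under the boundary condition): the head of the
crossed dart of `𝕋` (junk `0` past the end). (Smirnov 2001, §2.) [cite: Smirnov2001, §2] -/
def _root_.Literature.Probability.LatticeModels.IsExplorationPath.rv
    (hw : IsExplorationPath Dd ω w) (i : ℕ) : Site 2 :=
  if hi : i < w.length then (hw.step_getVert hi).choose.snd else 0

variable (hw : IsExplorationPath Dd ω w)

/-- The defining properties of the crossed dart of the `i`-th step: `lv i ∼ rv i`, its left and
right faces are `w.getVert (i+1)` and `w.getVert i`, it is an edge of `Ω_δ`, `lv i` is open and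
`rv i` is closed under the boundary condition. (Smirnov 2001, §2.) [cite: Smirnov2001, §2] -/
theorem _root_.Literature.Probability.LatticeModels.IsExplorationPath.dart_spec {i : ℕ} (hi : i < w.length) :
    ∃ h : triGraph.Adj (hw.lv i) (hw.rv i),
      triEdgeFaces ⟨(hw.lv i, hw.rv i), h⟩ = (w.getVert (i + 1), w.getVert i) ∧
      (triDiscreteDomainGraph Dd.Ω Dd.δ).Adj (hw.lv i) (hw.rv i) ∧
      hw.lv i ∈ Dd.bcConfig ω ∧ hw.rv i ∉ Dd.bcConfig ω := by
  have hs := (hw.step_getVert hi).choose_spec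
  set e := (hw.step_getVert hi).choose with he
  have hl : hw.lv i = e.fst := by
    simp only [IsExplorationPath.lv, dif_pos hi]; rfl
  have hr : hw.rv i = e.snd := by
    simp only [IsExplorationPath.rv, dif_pos hi]; rfl
  have hadj : triGraph.Adj (hw.lv i) (hw.rv i) := by rw [hl, hr]; exact e.adj
  refine ⟨hadj, ?_, by rw [hl, hr]; exact hs.2.1, by rw [hl]; exact hs.2.2.1,
    by rw [hr]; exact hs.2.2.2⟩
  have : (⟨(hw.lv i, hw.rv i), hadj⟩ : triGraph.Dart) = e :=
    SimpleGraph.Dart.ext _ _ (Prod.ext hl hr)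
  rw [this]
  exact hs.1

/-- `lv i` and `rv i` are adjacent in `𝕋`. [cite: Smirnov2001, §2] -/
theorem _root_.Literature.Probability.LatticeModels.IsExplorationPath.adj_lv_rv {i : ℕ} (hi : i < w.length) :
    triGraph.Adj (hw.lv i) (hw.rv i) :=
  (hw.dart_spec hi).1

/-- The crossed edge is an edge of the discrete domain `Ω_δ`. [cite: Smirnov2001, §2] -/
theorem _root_.Literature.Probability.LatticeModels.IsExplorationPath.domAdj_lv_rv {i : ℕ} (hi : i < w.length) :
    (triDiscreteDomainGraph Dd.Ω Dd.δ).Adj (hw.lv i) (hw.rv i) :=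
  (hw.dart_spec hi).2.2.1

/-- The left site is open under the boundary condition. [cite: Smirnov2001, §2] -/
theorem _root_.Literature.Probability.LatticeModels.IsExplorationPath.lv_mem_bcConfig {i : ℕ} (hi : i < w.length) :
    hw.lv i ∈ Dd.bcConfig ω :=
  (hw.dart_spec hi).2.2.2.1

/-- The right site is closed under the boundary condition. [cite: Smirnov2001, §2] -/
theorem _root_.Literature.Probability.LatticeModels.IsExplorationPath.rv_not_mem_bcConfig {i : ℕ} (hi : i < w.length) :
    hw.rv i ∉ Dd.bcConfig ω :=
  (hw.dart_spec hi).2.2.2.2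

/-- Left and right sites differ (one is open, the other closed). [cite: Smirnov2001, §2] -/
theorem _root_.Literature.Probability.LatticeModels.IsExplorationPath.lv_ne_rv {i j : ℕ} (hi : i < w.length)
    (hj : j < w.length) : hw.lv i ≠ hw.rv j := fun h ↦
  hw.rv_not_mem_bcConfig hj (h ▸ hw.lv_mem_bcConfig hi)

/-- **The side index of the `i`-th step**: the step reads
`w.getVert (i+1) = oppFace (w.getVert i) J`, `rv i = faceVertex (w.getVert i) (J+1)`,
`lv i = faceVertex (w.getVert i) (J+2)`. [folklore] -/
theorem _root_.Literature.Probability.LatticeModels.IsExplorationPath.exists_sideIdx {i : ℕ} (hi : i < w.length) :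
    ∃ J : Fin 3, w.getVert (i + 1) = oppFace (w.getVert i) J ∧
      hw.rv i = faceVertex (w.getVert i) (J + 1) ∧ hw.lv i = faceVertex (w.getVert i) (J + 2) := by
  obtain ⟨h, hfaces, -, -, -⟩ := hw.dart_spec hi
  obtain ⟨J, h1, h2, h3⟩ := exists_sideIdx_of_triEdgeFaces h
  have hR : (triEdgeFaces ⟨(hw.lv i, hw.rv i), h⟩).2 = w.getVert i := congrArg Prod.snd hfaces
  have hL : (triEdgeFaces ⟨(hw.lv i, hw.rv i), h⟩).1 = w.getVert (i + 1) := congrArg Prod.fst hfaces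
  rw [hR] at h1 h2 h3
  rw [hL] at h1
  exact ⟨J, h1, h2, h3⟩

/-- The side index of the `i`-th step (by choice; junk `0` past the end). [folklore] -/
def _root_.Literature.Probability.LatticeModels.IsExplorationPath.sideIdx (i : ℕ) : Fin 3 :=
  if hi : i < w.length then (hw.exists_sideIdx hi).choose else 0

/-- The next face is the opposite face across the side `sideIdx i`. [folklore] -/
theorem _root_.Literature.Probability.LatticeModels.IsExplorationPath.getVert_succ_eq {i : ℕ} (hi : i < w.length) :
    w.getVert (i + 1) = oppFace (w.getVert i) (hw.sideIdx i) := by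
  have := (hw.exists_sideIdx hi).choose_spec.1
  simp only [IsExplorationPath.sideIdx, dif_pos hi]
  exact this

/-- The right site is the vertex `sideIdx i + 1` of the current face. [folklore] -/
theorem _root_.Literature.Probability.LatticeModels.IsExplorationPath.rv_eq {i : ℕ} (hi : i < w.length) :
    hw.rv i = faceVertex (w.getVert i) (hw.sideIdx i + 1) := by
  have := (hw.exists_sideIdx hi).choose_spec.2.1
  simp only [IsExplorationPath.sideIdx, dif_pos hi]
  exact this

/-- The left site is the vertex `sideIdx i + 2` of the current face. [folklore] -/
theorem _root_.Literature.Probability.LatticeModels.IsExplorationPath.lv_eq {i : ℕ} (hi : i < w.length) :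
    hw.lv i = faceVertex (w.getVert i) (hw.sideIdx i + 2) := by
  have := (hw.exists_sideIdx hi).choose_spec.2.2
  simp only [IsExplorationPath.sideIdx, dif_pos hi]
  exact this

/-! ### Consecutive left (right) sites -/

/-- The two endpoints of the crossed edge are vertices of the *next* face as well (the shared
side is seen from both faces). [folklore] -/
theorem _root_.Literature.Probability.LatticeModels.IsExplorationPath.lv_mem_hexFaceVertices_succ {i : ℕ} (hi : i < w.length) :
    hw.lv i ∈ hexFaceVertices (w.getVert (i + 1)) := by
  rw [hw.getVert_succ_eq hi, hw.lv_eq hi, ← faceVertex_oppFace_succ]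
  exact faceVertex_mem _ _

/-- As `lv_mem_hexFaceVertices_succ`, for the right site. [folklore] -/
theorem _root_.Literature.Probability.LatticeModels.IsExplorationPath.rv_mem_hexFaceVertices_succ {i : ℕ} (hi : i < w.length) :
    hw.rv i ∈ hexFaceVertices (w.getVert (i + 1)) := by
  rw [hw.getVert_succ_eq hi, hw.rv_eq hi, ← faceVertex_oppFace_succ_succ]
  exact faceVertex_mem _ _

/-- The left site is a vertex of the current face. [folklore] -/
theorem _root_.Literature.Probability.LatticeModels.IsExplorationPath.lv_mem_hexFaceVertices {i : ℕ} (hi : i < w.length) :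
    hw.lv i ∈ hexFaceVertices (w.getVert i) := by
  rw [hw.lv_eq hi]; exact faceVertex_mem _ _

/-- The right site is a vertex of the current face. [folklore] -/
theorem _root_.Literature.Probability.LatticeModels.IsExplorationPath.rv_mem_hexFaceVertices {i : ℕ} (hi : i < w.length) :
    hw.rv i ∈ hexFaceVertices (w.getVert i) := by
  rw [hw.rv_eq hi]; exact faceVertex_mem _ _

/-- **Consecutive left sites are equal or adjacent** (both are vertices of the face in
between). (Smirnov 2001, §2: the open hexagons on the left of the exploration path form a
connected chain.) [cite: Smirnov2001, §2] -/
theorem _root_.Literature.Probability.LatticeModels.IsExplorationPath.lv_succ_eq_or_adj {i : ℕ} (hi : i + 1 < w.length) :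
    hw.lv (i + 1) = hw.lv i ∨ triGraph.Adj (hw.lv i) (hw.lv (i + 1)) := by
  by_cases h : hw.lv (i + 1) = hw.lv i
  · exact Or.inl h
  · exact Or.inr (adj_of_mem_hexFaceVertices (hw.lv_mem_hexFaceVertices_succ (by omega))
      (hw.lv_mem_hexFaceVertices hi) (Ne.symm h))

/-- **Consecutive right sites are equal or adjacent.** [cite: Smirnov2001, §2] -/
theorem _root_.Literature.Probability.LatticeModels.IsExplorationPath.rv_succ_eq_or_adj {i : ℕ} (hi : i + 1 < w.length) :
    hw.rv (i + 1) = hw.rv i ∨ triGraph.Adj (hw.rv i) (hw.rv (i + 1)) := by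
  by_cases h : hw.rv (i + 1) = hw.rv i
  · exact Or.inl h
  · exact Or.inr (adj_of_mem_hexFaceVertices (hw.rv_mem_hexFaceVertices_succ (by omega))
      (hw.rv_mem_hexFaceVertices hi) (Ne.symm h))

/-- **Distinct steps cross distinct edges**: if two steps have the same left and right sites
they coincide (the crossed dart determines both faces, and the walk is a path). [folklore] -/
theorem _root_.Literature.Probability.LatticeModels.IsExplorationPath.eq_of_lv_eq_of_rv_eq {i m : ℕ} (hi : i < w.length)
    (hm : m < w.length) (hl : hw.lv i = hw.lv m) (hr : hw.rv i = hw.rv m) : i = m := by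
  obtain ⟨h, hfi, -⟩ := hw.dart_spec hi
  obtain ⟨h', hfm, -⟩ := hw.dart_spec hm
  have hd : (⟨(hw.lv i, hw.rv i), h⟩ : triGraph.Dart) = ⟨(hw.lv m, hw.rv m), h'⟩ :=
    SimpleGraph.Dart.ext _ _ (Prod.ext hl hr)
  have : w.getVert i = w.getVert m := by
    have := congrArg Prod.snd (hfi.symm.trans ((congrArg triEdgeFaces hd).trans hfm))
    exact this
  exact hw.isPath.getVert_injOn (by exact hi.le) (by exact hm.le) this

end IsExplorationPath

/-! ### The polygon at mesh `δ`: vertices, pieces, trace, stretches -/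

section Polygon

variable {f₀ g₀ : HexVertex} (δ : ℝ) (w : hexGraph.Walk f₀ g₀)

/-- The `i`-th vertex of the exploration polygon at mesh `δ`: the rescaled centre of the `i`-th
face of the walk. (Smirnov 2001, §2.) [cite: Smirnov2001, §2] -/
def polyPt (i : ℕ) : ℂ := (δ : ℂ) * hexCenter (w.getVert i)

/-- The `i`-th **dart piece** of the polygon: the rescaled edge of the hexagonal lattice from
the `i`-th to the `(i+1)`-st face centre. [folklore] -/
def polyPiece (i : ℕ) : Set ℂ := segment ℝ (polyPt δ w i) (polyPt δ w (i + 1))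

/-- The **trace** of the polygon: the union of its dart pieces. [folklore] -/
def polyTrace : Set ℂ := ⋃ (i : ℕ) (_ : i < w.length), polyPiece δ w i

/-- The list of polygon vertices after the first. [folklore] -/
def tailPts : List ℂ := w.support.tail.map fun F ↦ (δ : ℂ) * hexCenter F

/-- **The stretch of the polygon over the darts `i₀, …, i₀ + k`**, as a path from the `i₀`-th
to the `(i₀ + k + 1)`-st vertex. [folklore] -/
def polySubPath (i₀ : ℕ) : ∀ k : ℕ, Path (polyPt δ w i₀) (polyPt δ w (i₀ + k + 1))
  | 0 => Path.segment (polyPt δ w i₀) (polyPt δ w (i₀ + 1))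
  | k + 1 => (polySubPath i₀ k).trans
      (Path.segment (polyPt δ w (i₀ + k + 1)) (polyPt δ w (i₀ + k + 1 + 1)))

variable {δ w}

/-- Membership in the trace, unfolded. [folklore] -/
theorem mem_polyTrace_iff {z : ℂ} : z ∈ polyTrace δ w ↔ ∃ i, i < w.length ∧ z ∈ polyPiece δ w i := by
  simp only [polyTrace, mem_iUnion, exists_prop]

/-- Dart pieces lie in the trace. [folklore] -/
theorem polyPiece_subset_polyTrace {i : ℕ} (hi : i < w.length) : polyPiece δ w i ⊆ polyTrace δ w :=
  fun _ hz ↦ mem_polyTrace_iff.2 ⟨i, hi, hz⟩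

/-- The tail list has `w.length` points. [folklore] -/
theorem length_tailPts : (tailPts δ w).length = w.length := by
  rw [tailPts, List.length_map, List.length_tail, SimpleGraph.Walk.length_support]
  rfl

/-- The points of the tail list are the polygon vertices after the first. [folklore] -/
theorem getElem_tailPts {j : ℕ} (hj : j < (tailPts δ w).length) :
    (tailPts δ w)[j] = polyPt δ w (j + 1) := by
  have hj' : j < w.length := by rwa [length_tailPts] at hj
  simp only [tailPts, List.getElem_map, List.getElem_tail, polyPt]
  rw [SimpleGraph.Walk.support_getElem_eq_getVert]

/-- The vertex list of the polygon is the first vertex followed by the tail. [folklore] -/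
theorem support_map_eq_cons :
    w.support.map (fun F ↦ (δ : ℂ) * hexCenter F) = polyPt δ w 0 :: tailPts δ w := by
  conv_lhs => rw [← w.cons_tail_support]
  rw [List.map_cons, polyPt, SimpleGraph.Walk.getVert_zero]
  rfl

/-- **The polygon of the walk is the polyline from the first vertex through the tail.**
(Smirnov 2001, §2: the exploration path as a polygonal curve.) [cite: Smirnov2001, §2] -/
theorem toCurve_apply (u : unitInterval) :
    w.toCurve (fun F ↦ (δ : ℂ) * hexCenter F) u = (polylineFrom (polyPt δ w 0) (tailPts δ w)).2 u := by
  change polyline (w.support.map fun F ↦ (δ : ℂ) * hexCenter F) u = _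
  rw [support_map_eq_cons]
  rfl

/-- The consecutive pairs of the vertex list are the endpoints of the dart pieces. [folklore] -/
theorem getElem_zip_tailPts {j : ℕ} (hj : j < ((polyPt δ w 0 :: tailPts δ w).zip (tailPts δ w)).length) :
    ((polyPt δ w 0 :: tailPts δ w).zip (tailPts δ w))[j] = (polyPt δ w j, polyPt δ w (j + 1)) := by
  have hj' : j < (tailPts δ w).length := by simpa using hj
  rw [List.getElem_zip]
  refine Prod.ext ?_ (getElem_tailPts hj')
  rcases j with _ | j
  · rfl
  · simp only [List.getElem_cons_succ]
    exact getElem_tailPts (by omega)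

/-- The index of the dart piece traversed at time `u` (capped at the last piece): the dyadic
segment index `pieceIdx` of `MedialExplorationChains.lean` (cf. `tIdx` of
`ExplorationPolygon.lean`, the same device for lists of medial vertices). [folklore] -/
def polyIdx (n : ℕ) (u : unitInterval) : ℕ := min (pieceIdx (List.replicate n (0 : ℕ)) u) (n - 1)

/-- `polyIdx` is monotone in time. [folklore] -/
theorem polyIdx_mono (n : ℕ) {u v : unitInterval} (h : u ≤ v) : polyIdx n u ≤ polyIdx n v :=
  min_le_min_right _ (pieceIdx_mono _ h)

/-- `polyIdx n` is computed from any list of length `n`. [folklore] -/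
theorem polyIdx_eq {V : Type*} (l : List V) (u : unitInterval) :
    polyIdx l.length u = min (pieceIdx l u) (l.length - 1) := by
  unfold polyIdx
  rw [← pieceIdx_map (fun _ : V ↦ (0 : ℕ)) l u, List.map_const']

/-- Every index between the indices of two times is the index of an intermediate time.
[folklore] -/
theorem exists_time_of_polyIdx (n : ℕ) {s t : unitInterval} (hst : s ≤ t) {i : ℕ}
    (h0 : polyIdx n s ≤ i) (h1 : i ≤ polyIdx n t) : ∃ u : unitInterval, s ≤ u ∧ u ≤ t ∧ polyIdx n u = i := by
  have hn : (List.replicate n (0 : ℕ)).length = n := List.length_replicate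
  have := exists_time_of_index (List.replicate n (0 : ℕ)) hst (i := i) (by rw [hn]; exact h0)
    (by rw [hn]; exact h1)
  obtain ⟨u, hsu, hut, hu⟩ := this
  exact ⟨u, hsu, hut, by rw [polyIdx, ← hu, hn]⟩

/-- **The polygon at time `u` lies on the dart piece of index `polyIdx u`.** [folklore] -/
theorem toCurve_mem_polyPiece (hlen : 0 < w.length) (u : unitInterval) :
    w.toCurve (fun F ↦ (δ : ℂ) * hexCenter F) u ∈ polyPiece δ w (polyIdx w.length u) := by
  rw [toCurve_apply, ← length_tailPts (δ := δ) (w := w), polyIdx_eq]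
  have hmem := polylineFrom_mem_segment_pieceAt (polyPt δ w 0) (tailPts δ w) u
  rcases pieceAt_eq_getElem_or (polyPt δ w 0) (tailPts δ w) u with ⟨h, heq⟩ | ⟨hidx, heq⟩
  · rw [heq, getElem_zip_tailPts h] at hmem
    have h' : pieceIdx (tailPts δ w) u < (tailPts δ w).length := by simpa using h
    have : min (pieceIdx (tailPts δ w) u) ((tailPts δ w).length - 1) = pieceIdx (tailPts δ w) u := by
      rw [min_eq_left]; omega
    rw [this]; exact hmem
  · -- the final constant stretch: the last vertex, right endpoint of the last piece
    have hlast : (polyPt δ w 0 :: tailPts δ w).getLast (by simp) = polyPt δ w w.length := by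
      rw [List.getLast_eq_getElem]
      have h1 : (polyPt δ w 0 :: tailPts δ w).length - 1 = w.length := by
        simp [length_tailPts]
      simp only [h1]
      rcases Nat.exists_eq_succ_of_ne_zero hlen.ne' with ⟨n, hn⟩
      have hn' : w.length = n + 1 := hn
      simp only [hn', List.getElem_cons_succ]
      rw [getElem_tailPts]
    rw [heq, hlast, segment_same, mem_singleton_iff] at hmem
    have : min (pieceIdx (tailPts δ w) u) ((tailPts δ w).length - 1) = w.length - 1 := by
      rw [hidx, length_tailPts, min_eq_right]; omega
    rw [hmem, this, polyPiece, Nat.sub_add_cancel hlen]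
    exact right_mem_segment _ _ _

/-- `polyIdx` is a valid dart index (for a walk with at least one dart). [folklore] -/
theorem polyIdx_lt {n : ℕ} (hlen : 0 < n) (u : unitInterval) : polyIdx n u < n := by
  unfold polyIdx; omega

/-- **The range of the polygon is the trace** (for a walk with at least one dart): every time
is spent on the piece `tIdx`, and every piece is traversed. [folklore] -/
theorem range_toCurve_subset_polyTrace (hlen : 0 < w.length) :
    range (w.toCurve fun F ↦ (δ : ℂ) * hexCenter F) ⊆ polyTrace δ w := by
  rintro _ ⟨u, rfl⟩
  exact polyPiece_subset_polyTrace (polyIdx_lt hlen u) (toCurve_mem_polyPiece hlen u)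

/-- The range of a stretch is the union of its dart pieces. [folklore] -/
theorem range_polySubPath_subset (i₀ : ℕ) :
    ∀ k : ℕ, range (polySubPath δ w i₀ k) ⊆ ⋃ (j : ℕ) (_ : j ≤ k), polyPiece δ w (i₀ + j)
  | 0 => by
    intro z hz
    rw [polySubPath, Path.range_segment] at hz
    exact mem_iUnion₂.2 ⟨0, le_rfl, hz⟩
  | k + 1 => by
    intro z hz
    rw [polySubPath, Path.trans_range, Path.range_segment] at hz
    rcases hz with hz | hz
    · obtain ⟨j, hj, h⟩ := mem_iUnion₂.1 (range_polySubPath_subset i₀ k hz)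
      exact mem_iUnion₂.2 ⟨j, by omega, h⟩
    · exact mem_iUnion₂.2 ⟨k + 1, le_rfl, hz⟩

/-- The range of a stretch lies in the trace. [folklore] -/
theorem range_polySubPath_subset_polyTrace {i₀ k : ℕ} (hk : i₀ + k < w.length) :
    range (polySubPath δ w i₀ k) ⊆ polyTrace δ w := by
  intro z hz
  obtain ⟨j, hj, h⟩ := mem_iUnion₂.1 (range_polySubPath_subset i₀ k hz)
  exact polyPiece_subset_polyTrace (by omega) h

/-- **A stretch all of whose pieces miss the segment `[ℓ, r]` has zero crossing defect.**
[folklore] -/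
theorem crossInc_polySubPath_eq_zero {ℓ r : ℂ} (i₀ : ℕ) : ∀ k : ℕ,
    (∀ j, j ≤ k → ∀ z ∈ polyPiece δ w (i₀ + j), z ∉ segment ℝ ℓ r) →
      (polySubPath δ w i₀ k).crossInc ℓ r = 0
  | 0 => by
    intro hd
    rw [polySubPath]
    refine Path.crossInc_eq_zero _ fun t ↦ hd 0 le_rfl _ ?_
    have : (Path.segment (polyPt δ w i₀) (polyPt δ w (i₀ + 1))) t ∈
        range (Path.segment (polyPt δ w i₀) (polyPt δ w (i₀ + 1))) := ⟨t, rfl⟩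
    rwa [Path.range_segment] at this
  | k + 1 => by
    intro hd
    have ih := crossInc_polySubPath_eq_zero i₀ k fun j hj ↦ hd j (by omega)
    have hoff : ∀ q, q ∈ segment ℝ ℓ r → q ∉ range (polySubPath δ w i₀ k) ∧
        q ∉ range (Path.segment (polyPt δ w (i₀ + k + 1)) (polyPt δ w (i₀ + k + 1 + 1))) := by
      intro q hq
      refine ⟨fun h ↦ ?_, fun h ↦ ?_⟩
      · obtain ⟨j, hj, h⟩ := mem_iUnion₂.1 (range_polySubPath_subset i₀ k h)
        exact hd j (by omega) q h hq
      · rw [Path.range_segment] at h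
        exact hd (k + 1) le_rfl q h hq
    obtain ⟨hl1, hl2⟩ := hoff ℓ (left_mem_segment _ _ _)
    obtain ⟨hr1, hr2⟩ := hoff r (right_mem_segment _ _ _)
    rw [polySubPath, Path.crossInc_trans _ _ hl1 hl2 hr1 hr2, ih, Path.crossInc_eq_zero, add_zero]
    intro t ht
    exact hd (k + 1) le_rfl _ (by
      have : (Path.segment (polyPt δ w (i₀ + k + 1)) (polyPt δ w (i₀ + k + 1 + 1))) t ∈
        range (Path.segment (polyPt δ w (i₀ + k + 1)) (polyPt δ w (i₀ + k + 1 + 1))) := ⟨t, rfl⟩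
      rwa [Path.range_segment] at this) ht

/-- **A stretch whose pieces miss `[ℓ, r]` except for one dart piece has the crossing defect
of that dart piece.** [folklore] -/
theorem crossInc_polySubPath_eq {ℓ r : ℂ} (i₀ j₀ : ℕ) : ∀ k : ℕ, j₀ ≤ k →
    (∀ j, j ≤ k → j ≠ j₀ → ∀ z ∈ polyPiece δ w (i₀ + j), z ∉ segment ℝ ℓ r) →
    ℓ ∉ polyPiece δ w (i₀ + j₀) → r ∉ polyPiece δ w (i₀ + j₀) →
      (polySubPath δ w i₀ k).crossInc ℓ r =
        (Path.segment (polyPt δ w (i₀ + j₀)) (polyPt δ w (i₀ + j₀ + 1))).crossInc ℓ r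
  | 0 => by
    intro hj₀ _ _ _
    obtain rfl : j₀ = 0 := by omega
    rfl
  | k + 1 => by
    intro hj₀ hd hℓ hr
    have hoff : ∀ q, q ∈ segment ℝ ℓ r → q ∉ polyPiece δ w (i₀ + j₀) →
        q ∉ range (polySubPath δ w i₀ k) ∧
        q ∉ range (Path.segment (polyPt δ w (i₀ + k + 1)) (polyPt δ w (i₀ + k + 1 + 1))) := by
      intro q hq hq'
      refine ⟨fun h ↦ ?_, fun h ↦ ?_⟩
      · obtain ⟨j, hj, h⟩ := mem_iUnion₂.1 (range_polySubPath_subset i₀ k h)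
        by_cases hjj : j = j₀
        · subst hjj; exact hq' h
        · exact hd j (by omega) hjj q h hq
      · rw [Path.range_segment] at h
        by_cases hjk : k + 1 = j₀
        · rw [show i₀ + k + 1 = i₀ + j₀ by omega] at h
          exact hq' h
        · exact hd (k + 1) le_rfl hjk q h hq
    obtain ⟨hl1, hl2⟩ := hoff ℓ (left_mem_segment _ _ _) hℓ
    obtain ⟨hr1, hr2⟩ := hoff r (right_mem_segment _ _ _) hr
    rw [polySubPath, Path.crossInc_trans _ _ hl1 hl2 hr1 hr2]
    by_cases hjk : j₀ ≤ k
    · rw [crossInc_polySubPath_eq i₀ j₀ k hjk (fun j hj ↦ hd j (by omega)) hℓ hr,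
        Path.crossInc_eq_zero (Path.segment (polyPt δ w (i₀ + k + 1)) (polyPt δ w (i₀ + k + 1 + 1))),
        add_zero]
      intro t ht
      exact hd (k + 1) le_rfl (by omega) _ (by
        have : (Path.segment (polyPt δ w (i₀ + k + 1)) (polyPt δ w (i₀ + k + 1 + 1))) t ∈
          range (Path.segment (polyPt δ w (i₀ + k + 1)) (polyPt δ w (i₀ + k + 1 + 1))) := ⟨t, rfl⟩
        rwa [Path.range_segment] at this) ht
    · obtain rfl : j₀ = k + 1 := by omega
      rw [crossInc_polySubPath_eq_zero i₀ k (fun j hj ↦ hd j (by omega) (by omega)), zero_add,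
        show i₀ + (k + 1) = i₀ + k + 1 by omega]

end Polygon

/-! ### Scaling helpers -/

/-- `triMeshPoint δ v = δ • triEmbed v`. [folklore] -/
theorem triMeshPoint_eq_smul (δ : ℝ) (v : Site 2) : triMeshPoint δ v = δ • triEmbed v := by
  rw [triMeshPoint, Complex.real_smul]

/-- Membership in a segment with endpoints scaled by `δ ≠ 0`. [folklore] -/
theorem mem_segment_mul_iff {δ : ℝ} (hδ : δ ≠ 0) {P Q z : ℂ} :
    z ∈ segment ℝ ((δ : ℂ) * P) ((δ : ℂ) * Q) ↔ (δ⁻¹ : ℝ) • z ∈ segment ℝ P Q := by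
  rw [← Complex.real_smul, ← Complex.real_smul]
  exact mem_segment_smul_iff hδ

/-- The side functional is homogeneous of degree two under real scaling. [folklore] -/
theorem segSide_real_mul (δ : ℝ) (ℓ r z : ℂ) :
    segSide ((δ : ℂ) * ℓ) ((δ : ℂ) * r) ((δ : ℂ) * z) = δ ^ 2 * segSide ℓ r z := by
  rw [segSide_eq, segSide_eq]
  simp only [Complex.mul_re, Complex.mul_im, Complex.ofReal_re, Complex.ofReal_im, zero_mul,
    sub_zero, add_zero]
  ring

/-! ### Transversality of a side and the dart piece across it (lattice units) -/

/-- **The centre of a face is on the positive side of each of its sides, read clockwise**: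
`segSide x_{j+2} x_{j+1} (centre) = √3/6 > 0` for the anticlockwise vertices `x_j` of the face.
[folklore] -/
theorem segSide_faceVertex_hexCenter (F : HexVertex) (j : Fin 3) :
    segSide (triEmbed (faceVertex F (j + 2))) (triEmbed (faceVertex F (j + 1))) (hexCenter F) =
      Real.sqrt 3 / 6 := by
  have h3 : Real.sqrt 3 * Real.sqrt 3 = 3 := Real.mul_self_sqrt (by norm_num)
  rcases F with ⟨x, t⟩
  obtain rfl | rfl : t = 0 ∨ t = 1 := by
    rcases Fin.exists_fin_two.1 ⟨t, rfl⟩ with h' | h'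
    · exact Or.inl h'
    · exact Or.inr h'
  all_goals obtain rfl | rfl | rfl : j = 0 ∨ j = 1 ∨ j = 2 := by fin_cases j <;> simp
  all_goals
    rw [segSide_eq]
    simp only [faceVertex, Fin.isValue, ↓reduceIte, one_ne_zero, Matrix.cons_val_zero, Matrix.cons_val_one,
      Matrix.cons_val_two, Matrix.head_cons, Matrix.tail_cons, hexCenter_re, hexCenter_im, triEmbed_re, triEmbed_im,
      zero_add, Fin.val_zero, Fin.val_one]
    simp
    nlinarith [h3]

/-- **The centre of the opposite face is on the negative side**:
`segSide x_{j+2} x_{j+1} (centre of oppFace F j) = -√3/6 < 0`. [folklore] -/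
theorem segSide_faceVertex_hexCenter_oppFace (F : HexVertex) (j : Fin 3) :
    segSide (triEmbed (faceVertex F (j + 2))) (triEmbed (faceVertex F (j + 1))) (hexCenter (oppFace F j)) =
      -(Real.sqrt 3 / 6) := by
  have h3 : Real.sqrt 3 * Real.sqrt 3 = 3 := Real.mul_self_sqrt (by norm_num)
  rcases F with ⟨x, t⟩
  obtain rfl | rfl : t = 0 ∨ t = 1 := by
    rcases Fin.exists_fin_two.1 ⟨t, rfl⟩ with h' | h'
    · exact Or.inl h'
    · exact Or.inr h'
  all_goals obtain rfl | rfl | rfl : j = 0 ∨ j = 1 ∨ j = 2 := by fin_cases j <;> simp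
  all_goals
    rw [segSide_eq]
    simp only [oppFace, faceVertex, Fin.isValue, ↓reduceIte, one_ne_zero, Matrix.cons_val_zero, Matrix.cons_val_one,
      Matrix.cons_val_two, Matrix.head_cons, Matrix.tail_cons, hexCenter_re, hexCenter_im, triEmbed_re, triEmbed_im,
      zero_add, Fin.val_zero, Fin.val_one]
    simp
    nlinarith [h3]

/-- The midpoint of the two centres lies strictly inside the common side, read in either
orientation. [folklore] -/
theorem midpoint_hexCenter_mem_openSegment (F : HexVertex) (j : Fin 3) :
    midpoint ℝ (hexCenter F) (hexCenter (oppFace F j)) ∈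
      openSegment ℝ (triEmbed (faceVertex F (j + 2))) (triEmbed (faceVertex F (j + 1))) := by
  rw [midpoint_hexCenter_oppFace, openSegment_symm, midpoint_eq_smul_add, openSegment_eq_image]
  refine ⟨1 / 2, ⟨by norm_num, by norm_num⟩, ?_⟩
  simp only [smul_add]
  norm_num

section SidePoints

variable {Dd : DiscreteDobrushin} {ω : SiteConfig (Site 2)} {f₀ g₀ : HexVertex}
  {w : hexGraph.Walk f₀ g₀} (hw : IsExplorationPath Dd ω w)

include hw

/-! ### Side points and side segments -/

/-- The **left point** of the `i`-th step: its left site, at mesh `δ`. [folklore] -/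
def _root_.Literature.Probability.LatticeModels.IsExplorationPath.leftPt (i : ℕ) : ℂ := triMeshPoint Dd.δ (hw.lv i)

/-- The **right point** of the `i`-th step: its right site, at mesh `δ`. [folklore] -/
def _root_.Literature.Probability.LatticeModels.IsExplorationPath.rightPt (i : ℕ) : ℂ := triMeshPoint Dd.δ (hw.rv i)

/-- The **side segment** of the `i`-th step: the crossed edge of `δ𝕋`, from the left point to
the right point. [folklore] -/
def _root_.Literature.Probability.LatticeModels.IsExplorationPath.sideSeg (i : ℕ) : Set ℂ := segment ℝ (hw.leftPt i) (hw.rightPt i)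

/-- **A unit edge of `δ𝕋` (or a lattice point) meeting a dart piece is the crossed edge of that
step** (`eq_side_of_segment_inter_segment_hexCenter` at mesh `δ`). [folklore] -/
theorem _root_.Literature.Probability.LatticeModels.IsExplorationPath.eq_lv_rv_of_inter (hδ : 0 < Dd.δ) {a b : Site 2}
    (hab : a = b ∨ triGraph.Adj a b) {i : ℕ} (hi : i < w.length) {q : ℂ}
    (hq1 : q ∈ segment ℝ (triMeshPoint Dd.δ a) (triMeshPoint Dd.δ b)) (hq2 : q ∈ polyPiece Dd.δ w i) :
    (a = hw.rv i ∧ b = hw.lv i) ∨ (a = hw.lv i ∧ b = hw.rv i) := by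
  rw [triMeshPoint, triMeshPoint, mem_segment_mul_iff hδ.ne'] at hq1
  rw [polyPiece, polyPt, polyPt, mem_segment_mul_iff hδ.ne', hw.getVert_succ_eq hi] at hq2
  rcases eq_side_of_segment_inter_segment_hexCenter hab hq1 hq2 with ⟨ha, hb⟩ | ⟨ha, hb⟩
  · left; exact ⟨ha.trans (hw.rv_eq hi).symm, hb.trans (hw.lv_eq hi).symm⟩
  · right; exact ⟨ha.trans (hw.lv_eq hi).symm, hb.trans (hw.rv_eq hi).symm⟩

/-- **Lattice points are off the dart pieces.** [folklore] -/
theorem _root_.Literature.Probability.LatticeModels.IsExplorationPath.triMeshPoint_not_mem_polyPiece (hδ : 0 < Dd.δ) (a : Site 2) {i : ℕ}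
    (hi : i < w.length) : triMeshPoint Dd.δ a ∉ polyPiece Dd.δ w i := by
  intro h
  rcases hw.eq_lv_rv_of_inter hδ (Or.inl rfl) hi (left_mem_segment ℝ _ (triMeshPoint Dd.δ a)) h with
    ⟨h1, h2⟩ | ⟨h1, h2⟩
  · exact hw.lv_ne_rv hi hi (h2.symm.trans h1)
  · exact hw.lv_ne_rv hi hi (h1.symm.trans h2)

/-- **Lattice points are off the trace.** [folklore] -/
theorem _root_.Literature.Probability.LatticeModels.IsExplorationPath.triMeshPoint_not_mem_polyTrace (hδ : 0 < Dd.δ) (a : Site 2) :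
    triMeshPoint Dd.δ a ∉ polyTrace Dd.δ w := by
  intro h
  obtain ⟨i, hi, h⟩ := mem_polyTrace_iff.1 h
  exact hw.triMeshPoint_not_mem_polyPiece hδ a hi h

/-- The left point is off the trace. [folklore] -/
theorem _root_.Literature.Probability.LatticeModels.IsExplorationPath.leftPt_not_mem_polyTrace (hδ : 0 < Dd.δ) (m : ℕ) :
    hw.leftPt m ∉ polyTrace Dd.δ w :=
  hw.triMeshPoint_not_mem_polyTrace hδ _

/-- The right point is off the trace. [folklore] -/
theorem _root_.Literature.Probability.LatticeModels.IsExplorationPath.rightPt_not_mem_polyTrace (hδ : 0 < Dd.δ) (m : ℕ) :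
    hw.rightPt m ∉ polyTrace Dd.δ w :=
  hw.triMeshPoint_not_mem_polyTrace hδ _

/-- **An edge of `δ𝕋` between two open sites (or an open lattice point) misses the trace**:
a crossed edge has a closed endpoint. [folklore] -/
theorem _root_.Literature.Probability.LatticeModels.IsExplorationPath.segment_disjoint_polyTrace_of_mem_bcConfig (hδ : 0 < Dd.δ)
    {a b : Site 2} (hab : a = b ∨ triGraph.Adj a b) (ha : a ∈ Dd.bcConfig ω) (hb : b ∈ Dd.bcConfig ω) :
    Disjoint (segment ℝ (triMeshPoint Dd.δ a) (triMeshPoint Dd.δ b)) (polyTrace Dd.δ w) := by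
  refine disjoint_left.2 fun q hq1 hq ↦ ?_
  obtain ⟨i, hi, hq2⟩ := mem_polyTrace_iff.1 hq
  rcases hw.eq_lv_rv_of_inter hδ hab hi hq1 hq2 with ⟨h1, -⟩ | ⟨-, h2⟩
  · exact hw.rv_not_mem_bcConfig hi (h1 ▸ ha)
  · exact hw.rv_not_mem_bcConfig hi (h2 ▸ hb)

/-- **An edge of `δ𝕋` between two closed sites (or a closed lattice point) misses the trace.**
[folklore] -/
theorem _root_.Literature.Probability.LatticeModels.IsExplorationPath.segment_disjoint_polyTrace_of_not_mem_bcConfig (hδ : 0 < Dd.δ)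
    {a b : Site 2} (hab : a = b ∨ triGraph.Adj a b) (ha : a ∉ Dd.bcConfig ω) (hb : b ∉ Dd.bcConfig ω) :
    Disjoint (segment ℝ (triMeshPoint Dd.δ a) (triMeshPoint Dd.δ b)) (polyTrace Dd.δ w) := by
  refine disjoint_left.2 fun q hq1 hq ↦ ?_
  obtain ⟨i, hi, hq2⟩ := mem_polyTrace_iff.1 hq
  rcases hw.eq_lv_rv_of_inter hδ hab hi hq1 hq2 with ⟨-, h2⟩ | ⟨h1, -⟩
  · exact hb (h2 ▸ hw.lv_mem_bcConfig hi)
  · exact ha (h1 ▸ hw.lv_mem_bcConfig hi)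

/-- **An edge of `𝕋` which is not an edge of `Ω_δ` misses the trace** (steps cross edges of
`Ω_δ` only). [folklore] -/
theorem _root_.Literature.Probability.LatticeModels.IsExplorationPath.segment_disjoint_polyTrace_of_not_domAdj (hδ : 0 < Dd.δ)
    {a b : Site 2} (hab : triGraph.Adj a b) (hdom : ¬ (triDiscreteDomainGraph Dd.Ω Dd.δ).Adj a b) :
    Disjoint (segment ℝ (triMeshPoint Dd.δ a) (triMeshPoint Dd.δ b)) (polyTrace Dd.δ w) := by
  refine disjoint_left.2 fun q hq1 hq ↦ ?_
  obtain ⟨i, hi, hq2⟩ := mem_polyTrace_iff.1 hq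
  have hd := hw.domAdj_lv_rv hi
  rcases hw.eq_lv_rv_of_inter hδ (Or.inr hab) hi hq1 hq2 with ⟨h1, h2⟩ | ⟨h1, h2⟩
  · exact hdom (h1 ▸ h2 ▸ hd.symm)
  · exact hdom (h1 ▸ h2 ▸ hd)

/-- **Consecutive left points are joined off the trace** (by a point or an edge of `δ𝕋`
between two open sites). [folklore] -/
theorem _root_.Literature.Probability.LatticeModels.IsExplorationPath.segment_leftPt_disjoint_polyTrace (hδ : 0 < Dd.δ) {i : ℕ}
    (hi : i + 1 < w.length) :
    Disjoint (segment ℝ (hw.leftPt i) (hw.leftPt (i + 1))) (polyTrace Dd.δ w) := by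
  refine hw.segment_disjoint_polyTrace_of_mem_bcConfig hδ ?_ (hw.lv_mem_bcConfig (by omega))
    (hw.lv_mem_bcConfig hi)
  rcases hw.lv_succ_eq_or_adj hi with h | h
  · exact Or.inl h.symm
  · exact Or.inr h

/-- **Consecutive right points are joined off the trace.** [folklore] -/
theorem _root_.Literature.Probability.LatticeModels.IsExplorationPath.segment_rightPt_disjoint_polyTrace (hδ : 0 < Dd.δ) {i : ℕ}
    (hi : i + 1 < w.length) :
    Disjoint (segment ℝ (hw.rightPt i) (hw.rightPt (i + 1))) (polyTrace Dd.δ w) := by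
  refine hw.segment_disjoint_polyTrace_of_not_mem_bcConfig hδ ?_ (hw.rv_not_mem_bcConfig (by omega))
    (hw.rv_not_mem_bcConfig hi)
  rcases hw.rv_succ_eq_or_adj hi with h | h
  · exact Or.inl h.symm
  · exact Or.inr h

/-- **Only the `m`-th dart piece meets the `m`-th side segment**: other pieces miss it.
[folklore] -/
theorem _root_.Literature.Probability.LatticeModels.IsExplorationPath.polyPiece_disjoint_sideSeg (hδ : 0 < Dd.δ) {i m : ℕ}
    (hi : i < w.length) (hm : m < w.length) (him : i ≠ m) :
    Disjoint (polyPiece Dd.δ w i) (hw.sideSeg m) := by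
  refine disjoint_left.2 fun q hq2 hq1 ↦ him ?_
  rcases hw.eq_lv_rv_of_inter hδ (Or.inr (hw.adj_lv_rv hm)) hi hq1 hq2 with ⟨h1, -⟩ | ⟨h1, h2⟩
  · exact absurd h1 (hw.lv_ne_rv hm hi)
  · exact (hw.eq_of_lv_eq_of_rv_eq hm hi h1 h2).symm

/-! ### Metric bookkeeping -/

/-- **Both ends of a dart piece are within `δ` of its left point** (the circumradius of a
face of `δ𝕋` is `δ/√3`). [folklore] -/
theorem _root_.Literature.Probability.LatticeModels.IsExplorationPath.dist_polyPt_leftPt_le (hδ : 0 ≤ Dd.δ) {i : ℕ} (hi : i < w.length) :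
    dist (polyPt Dd.δ w i) (hw.leftPt i) ≤ Dd.δ ∧ dist (polyPt Dd.δ w (i + 1)) (hw.leftPt i) ≤ Dd.δ := by
  obtain ⟨h, hfaces, -⟩ := hw.dart_spec hi
  obtain ⟨h1, h2⟩ := hexCenter_triEdgeFaces_mem_closedBall hδ ⟨(hw.lv i, hw.rv i), h⟩
  rw [hfaces] at h1 h2
  exact ⟨h2, h1⟩

/-- **Both ends of a dart piece are within `δ` of its right point.** [folklore] -/
theorem _root_.Literature.Probability.LatticeModels.IsExplorationPath.dist_polyPt_rightPt_le (hδ : 0 ≤ Dd.δ) {i : ℕ} (hi : i < w.length) :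
    dist (polyPt Dd.δ w i) (hw.rightPt i) ≤ Dd.δ ∧ dist (polyPt Dd.δ w (i + 1)) (hw.rightPt i) ≤ Dd.δ := by
  obtain ⟨h, hfaces, -⟩ := hw.dart_spec hi
  have hs := triEdgeFaces_symm_holds ⟨(hw.lv i, hw.rv i), h⟩
  rw [hfaces] at hs
  obtain ⟨h1, h2⟩ := hexCenter_triEdgeFaces_mem_closedBall hδ (⟨(hw.lv i, hw.rv i), h⟩ : triGraph.Dart).symm
  rw [hs] at h1 h2
  exact ⟨h1, h2⟩

/-- The side segment has length `δ`. [folklore] -/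
theorem _root_.Literature.Probability.LatticeModels.IsExplorationPath.dist_leftPt_rightPt (hδ : 0 ≤ Dd.δ) {i : ℕ} (hi : i < w.length) :
    dist (hw.leftPt i) (hw.rightPt i) = Dd.δ := by
  have h1 := (triGraph_adj_iff_dist_holds _ _).1 (hw.adj_lv_rv hi)
  rw [IsExplorationPath.leftPt, IsExplorationPath.rightPt, triMeshPoint, triMeshPoint, dist_eq_norm,
    ← mul_sub, norm_mul, Complex.norm_real, Real.norm_eq_abs, abs_of_nonneg hδ, h1, mul_one]

/-- A dart piece lies in the `δ`-ball about its left point. [folklore] -/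
theorem _root_.Literature.Probability.LatticeModels.IsExplorationPath.polyPiece_subset_closedBall (hδ : 0 ≤ Dd.δ) {i : ℕ} (hi : i < w.length) :
    polyPiece Dd.δ w i ⊆ closedBall (hw.leftPt i) Dd.δ := by
  obtain ⟨h1, h2⟩ := hw.dist_polyPt_leftPt_le hδ hi
  exact (convex_closedBall _ _).segment_subset (mem_closedBall.2 h1) (mem_closedBall.2 h2)

/-- The side segment lies in the `δ`-ball about the left point. [folklore] -/
theorem _root_.Literature.Probability.LatticeModels.IsExplorationPath.sideSeg_subset_closedBall (hδ : 0 ≤ Dd.δ) {i : ℕ} (hi : i < w.length) :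
    hw.sideSeg i ⊆ closedBall (hw.leftPt i) Dd.δ :=
  (convex_closedBall _ _).segment_subset (mem_closedBall_self hδ)
    (mem_closedBall.2 (by rw [dist_comm, hw.dist_leftPt_rightPt hδ hi]))

/-! ### The `m`-th dart piece crosses the `m`-th side segment once, transversally -/

/-- The start of the `i`-th piece is on the positive side of the `i`-th side segment.
[folklore] -/
theorem _root_.Literature.Probability.LatticeModels.IsExplorationPath.segSide_polyPt_pos (hδ : 0 < Dd.δ) {i : ℕ} (hi : i < w.length) :
    0 < segSide (hw.leftPt i) (hw.rightPt i) (polyPt Dd.δ w i) := by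
  rw [IsExplorationPath.leftPt, IsExplorationPath.rightPt, triMeshPoint, triMeshPoint, polyPt, segSide_real_mul,
    hw.lv_eq hi, hw.rv_eq hi, segSide_faceVertex_hexCenter]
  positivity

/-- The end of the `i`-th piece is on the negative side of the `i`-th side segment.
[folklore] -/
theorem _root_.Literature.Probability.LatticeModels.IsExplorationPath.segSide_polyPt_succ_neg (hδ : 0 < Dd.δ) {i : ℕ} (hi : i < w.length) :
    segSide (hw.leftPt i) (hw.rightPt i) (polyPt Dd.δ w (i + 1)) < 0 := by
  rw [IsExplorationPath.leftPt, IsExplorationPath.rightPt, triMeshPoint, triMeshPoint, polyPt, segSide_real_mul,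
    hw.lv_eq hi, hw.rv_eq hi, hw.getVert_succ_eq hi, segSide_faceVertex_hexCenter_oppFace]
  have : 0 < Real.sqrt 3 / 6 := by positivity
  have hδ2 : 0 < Dd.δ ^ 2 := by positivity
  nlinarith

/-- The `i`-th piece and the `i`-th side segment cross at their common midpoint.
[folklore] -/
theorem _root_.Literature.Probability.LatticeModels.IsExplorationPath.exists_cross {i : ℕ} (hi : i < w.length) :
    ∃ p ∈ polyPiece Dd.δ w i, p ∈ openSegment ℝ (hw.leftPt i) (hw.rightPt i) := by
  refine ⟨(Dd.δ : ℂ) * midpoint ℝ (hexCenter (w.getVert i)) (hexCenter (oppFace (w.getVert i) (hw.sideIdx i))),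
    ?_, ?_⟩
  · rw [polyPiece, polyPt, polyPt, hw.getVert_succ_eq hi, ← Complex.real_smul, ← Complex.real_smul,
      ← Complex.real_smul, ← smul_segment_eq]
    exact smul_mem_smul_set (midpoint_mem_segment _ _)
  · rw [IsExplorationPath.leftPt, IsExplorationPath.rightPt, triMeshPoint, triMeshPoint, hw.lv_eq hi, hw.rv_eq hi,
      ← Complex.real_smul, ← Complex.real_smul, ← Complex.real_smul, openSegment_eq_image]
    obtain ⟨θ, hθ, hθeq⟩ := (openSegment_eq_image (𝕜 := ℝ) (triEmbed (faceVertex (w.getVert i) (hw.sideIdx i + 2)))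
      (triEmbed (faceVertex (w.getVert i) (hw.sideIdx i + 1)))).symm ▸
        midpoint_hexCenter_mem_openSegment (w.getVert i) (hw.sideIdx i)
    refine ⟨θ, hθ, ?_⟩
    simp only at hθeq ⊢
    rw [← hθeq, smul_add, smul_comm (Dd.δ) θ, smul_comm (Dd.δ) (1 - θ)]

/-- **The `i`-th dart piece has crossing defect `2πi` relative to its side segment.**
[folklore] -/
theorem _root_.Literature.Probability.LatticeModels.IsExplorationPath.crossInc_polyPiece (hδ : 0 < Dd.δ) {i : ℕ} (hi : i < w.length) :
    (Path.segment (polyPt Dd.δ w i) (polyPt Dd.δ w (i + 1))).crossInc (hw.leftPt i) (hw.rightPt i) =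
      2 * Real.pi * Complex.I :=
  Path.crossInc_segment_of_cross (hw.segSide_polyPt_pos hδ hi) (hw.segSide_polyPt_succ_neg hδ hi)
    (hw.exists_cross hi)

/-! ### Distances between consecutive side points -/

omit hw in
/-- Mesh points of equal or adjacent sites are within `δ`. [folklore] -/
theorem dist_triMeshPoint_le_of_eq_or_adj {δ : ℝ} (hδ : 0 ≤ δ) {a b : Site 2} (hab : a = b ∨ triGraph.Adj a b) :
    dist (triMeshPoint δ a) (triMeshPoint δ b) ≤ δ := by
  rcases hab with rfl | h
  · rw [dist_self]; exact hδ
  · have h1 := (triGraph_adj_iff_dist_holds _ _).1 h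
    rw [triMeshPoint, triMeshPoint, dist_eq_norm, ← mul_sub, norm_mul, Complex.norm_real, Real.norm_eq_abs,
      abs_of_nonneg hδ, h1, mul_one]

/-- Consecutive left points are within `δ`. [folklore] -/
theorem _root_.Literature.Probability.LatticeModels.IsExplorationPath.dist_leftPt_succ_le (hδ : 0 ≤ Dd.δ) {i : ℕ} (hi : i + 1 < w.length) :
    dist (hw.leftPt i) (hw.leftPt (i + 1)) ≤ Dd.δ := by
  refine dist_triMeshPoint_le_of_eq_or_adj hδ ?_
  rcases hw.lv_succ_eq_or_adj hi with h | h
  exacts [Or.inl h.symm, Or.inr h]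

/-- Consecutive right points are within `δ`. [folklore] -/
theorem _root_.Literature.Probability.LatticeModels.IsExplorationPath.dist_rightPt_succ_le (hδ : 0 ≤ Dd.δ) {i : ℕ} (hi : i + 1 < w.length) :
    dist (hw.rightPt i) (hw.rightPt (i + 1)) ≤ Dd.δ := by
  refine dist_triMeshPoint_le_of_eq_or_adj hδ ?_
  rcases hw.rv_succ_eq_or_adj hi with h | h
  exacts [Or.inl h.symm, Or.inr h]

/-! ### Chains stay in side components -/

/-- **Left points of a stretch lie in one component.** If the `δ`-neighbourhoods of the left
points of the steps `i₀, …, i₁` lie in the set `A`, then in `A` minus the trace all these left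
points lie in the component of any one of them (consecutive ones are joined by a point or an
open–open edge of `δ𝕋`, off the trace). [folklore] -/
theorem _root_.Literature.Probability.LatticeModels.IsExplorationPath.leftPt_mem_connectedComponentIn (hδ : 0 < Dd.δ) {A : Set ℂ}
    {i₀ i₁ : ℕ} (hi₁ : i₁ < w.length)
    (hball : ∀ i, i₀ ≤ i → i ≤ i₁ → closedBall (hw.leftPt i) Dd.δ ⊆ A)
    {i m : ℕ} (hi₀ : i₀ ≤ i) (hi : i ≤ i₁) (hm₀ : i₀ ≤ m) (hm : m ≤ i₁) :
    hw.leftPt i ∈ connectedComponentIn (A \ polyTrace Dd.δ w) (hw.leftPt m) := by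
  have key : ∀ k, i₀ + k ≤ i₁ → connectedComponentIn (A \ polyTrace Dd.δ w) (hw.leftPt (i₀ + k)) =
      connectedComponentIn (A \ polyTrace Dd.δ w) (hw.leftPt i₀) := by
    intro k
    induction k with
    | zero => intro; rfl
    | succ k ih =>
      intro hk
      rw [← ih (by omega), show i₀ + (k + 1) = i₀ + k + 1 by omega]
      refine connectedComponentIn_eq ?_
      have hseg : segment ℝ (hw.leftPt (i₀ + k)) (hw.leftPt (i₀ + k + 1)) ⊆ A \ polyTrace Dd.δ w := by
        intro z hz
        refine ⟨hball (i₀ + k) (by omega) (by omega) ?_,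
          disjoint_left.1 (hw.segment_leftPt_disjoint_polyTrace hδ (i := i₀ + k) (by omega)) hz⟩
        have h := hw.dist_leftPt_succ_le hδ.le (i := i₀ + k) (by omega)
        exact (convex_closedBall _ _).segment_subset (mem_closedBall_self hδ.le)
          (mem_closedBall.2 (by rw [dist_comm]; exact h)) hz
      have hconn : IsPreconnected (segment ℝ (hw.leftPt (i₀ + k)) (hw.leftPt (i₀ + k + 1))) :=
        (convex_segment _ _).isPreconnected
      exact hconn.subset_connectedComponentIn (right_mem_segment _ _ _) hseg (left_mem_segment _ _ _)
  obtain ⟨k, rfl⟩ : ∃ k, i = i₀ + k := ⟨i - i₀, by omega⟩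
  obtain ⟨k', rfl⟩ : ∃ k', m = i₀ + k' := ⟨m - i₀, by omega⟩
  have h1 := key k (by omega)
  have h2 := key k' (by omega)
  have hmem : hw.leftPt (i₀ + k) ∈ connectedComponentIn (A \ polyTrace Dd.δ w) (hw.leftPt (i₀ + k)) :=
    mem_connectedComponentIn ⟨hball (i₀ + k) (by omega) (by omega) (mem_closedBall_self hδ.le),
      hw.leftPt_not_mem_polyTrace hδ _⟩
  rw [h1, ← h2] at hmem
  exact hmem

/-- **Right points of a stretch lie in one component** (consecutive ones are joined by a point
or a closed–closed edge of `δ𝕋`, off the trace). [folklore] -/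
theorem _root_.Literature.Probability.LatticeModels.IsExplorationPath.rightPt_mem_connectedComponentIn (hδ : 0 < Dd.δ) {A : Set ℂ}
    {i₀ i₁ : ℕ} (hi₁ : i₁ < w.length)
    (hball : ∀ i, i₀ ≤ i → i ≤ i₁ → closedBall (hw.rightPt i) Dd.δ ⊆ A)
    {i m : ℕ} (hi₀ : i₀ ≤ i) (hi : i ≤ i₁) (hm₀ : i₀ ≤ m) (hm : m ≤ i₁) :
    hw.rightPt i ∈ connectedComponentIn (A \ polyTrace Dd.δ w) (hw.rightPt m) := by
  have key : ∀ k, i₀ + k ≤ i₁ → connectedComponentIn (A \ polyTrace Dd.δ w) (hw.rightPt (i₀ + k)) =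
      connectedComponentIn (A \ polyTrace Dd.δ w) (hw.rightPt i₀) := by
    intro k
    induction k with
    | zero => intro; rfl
    | succ k ih =>
      intro hk
      rw [← ih (by omega), show i₀ + (k + 1) = i₀ + k + 1 by omega]
      refine connectedComponentIn_eq ?_
      have hseg : segment ℝ (hw.rightPt (i₀ + k)) (hw.rightPt (i₀ + k + 1)) ⊆ A \ polyTrace Dd.δ w := by
        intro z hz
        refine ⟨hball (i₀ + k) (by omega) (by omega) ?_,
          disjoint_left.1 (hw.segment_rightPt_disjoint_polyTrace hδ (i := i₀ + k) (by omega)) hz⟩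
        have h := hw.dist_rightPt_succ_le hδ.le (i := i₀ + k) (by omega)
        exact (convex_closedBall _ _).segment_subset (mem_closedBall_self hδ.le)
          (mem_closedBall.2 (by rw [dist_comm]; exact h)) hz
      have hconn : IsPreconnected (segment ℝ (hw.rightPt (i₀ + k)) (hw.rightPt (i₀ + k + 1))) :=
        (convex_segment _ _).isPreconnected
      exact hconn.subset_connectedComponentIn (right_mem_segment _ _ _) hseg (left_mem_segment _ _ _)
  obtain ⟨k, rfl⟩ : ∃ k, i = i₀ + k := ⟨i - i₀, by omega⟩
  obtain ⟨k', rfl⟩ : ∃ k', m = i₀ + k' := ⟨m - i₀, by omega⟩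
  have h1 := key k (by omega)
  have h2 := key k' (by omega)
  have hmem : hw.rightPt (i₀ + k) ∈ connectedComponentIn (A \ polyTrace Dd.δ w) (hw.rightPt (i₀ + k)) :=
    mem_connectedComponentIn ⟨hball (i₀ + k) (by omega) (by omega) (mem_closedBall_self hδ.le),
      hw.rightPt_not_mem_polyTrace hδ _⟩
  rw [h1, ← h2] at hmem
  exact hmem

/-! ### Stretches as in-to-out paths, with their crossing defects -/

/-- **A stretch joining the inner disc to the outside of the annulus, read as an in-to-out
path**, with its crossing defects: nonzero relative to the side segment of a step of the
stretch, zero relative to the side segment of a step outside the stretch. [folklore] -/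
theorem _root_.Literature.Probability.LatticeModels.IsExplorationPath.exists_inout_path (hδ : 0 < Dd.δ) {x : ℂ} {r₁ r₂ : ℝ} {i₀ k : ℕ}
    (hk : i₀ + k < w.length)
    (hends : (dist (polyPt Dd.δ w i₀) x ≤ r₁ ∧ r₂ ≤ dist (polyPt Dd.δ w (i₀ + k + 1)) x) ∨
      (r₂ ≤ dist (polyPt Dd.δ w i₀) x ∧ dist (polyPt Dd.δ w (i₀ + k + 1)) x ≤ r₁)) :
    ∃ (Pin Pout : ℂ) (κ : Path Pin Pout), dist Pin x ≤ r₁ ∧ r₂ ≤ dist Pout x ∧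
      range κ ⊆ polyTrace Dd.δ w ∧
      (∀ m, i₀ ≤ m → m ≤ i₀ + k → κ.crossInc (hw.leftPt m) (hw.rightPt m) ≠ 0) ∧
      (∀ m, m < w.length → (m < i₀ ∨ i₀ + k < m) → κ.crossInc (hw.leftPt m) (hw.rightPt m) = 0) := by
  have hpi : (2 * Real.pi * Complex.I : ℂ) ≠ 0 := by simp [Real.pi_ne_zero, Complex.I_ne_zero]
  -- crossing defects of the stretch itself
  have hne : ∀ m, i₀ ≤ m → m ≤ i₀ + k →
      (polySubPath Dd.δ w i₀ k).crossInc (hw.leftPt m) (hw.rightPt m) ≠ 0 := by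
    intro m hm1 hm2
    have hm : m < w.length := by omega
    rw [crossInc_polySubPath_eq i₀ (m - i₀) k (by omega)
      (fun j hj hjm z hz hz' ↦ disjoint_left.1 (hw.polyPiece_disjoint_sideSeg hδ (by omega) hm (by omega)) hz hz')
      (fun h ↦ hw.leftPt_not_mem_polyTrace hδ m (polyPiece_subset_polyTrace (by omega) h))
      (fun h ↦ hw.rightPt_not_mem_polyTrace hδ m (polyPiece_subset_polyTrace (by omega) h)),
      show i₀ + (m - i₀) = m by omega, hw.crossInc_polyPiece hδ hm]
    exact hpi
  have hze : ∀ m, m < w.length → (m < i₀ ∨ i₀ + k < m) →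
      (polySubPath Dd.δ w i₀ k).crossInc (hw.leftPt m) (hw.rightPt m) = 0 := by
    intro m hm hm'
    exact crossInc_polySubPath_eq_zero i₀ k fun j hj z hz hz' ↦
      disjoint_left.1 (hw.polyPiece_disjoint_sideSeg hδ (by omega) hm (by omega)) hz hz'
  have hrange : range (polySubPath Dd.δ w i₀ k) ⊆ polyTrace Dd.δ w := range_polySubPath_subset_polyTrace hk
  have hoff : ∀ m, hw.leftPt m ∉ range (polySubPath Dd.δ w i₀ k) ∧ hw.rightPt m ∉ range (polySubPath Dd.δ w i₀ k) :=
    fun m ↦ ⟨fun h ↦ hw.leftPt_not_mem_polyTrace hδ m (hrange h), fun h ↦ hw.rightPt_not_mem_polyTrace hδ m (hrange h)⟩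
  rcases hends with ⟨h1, h2⟩ | ⟨h1, h2⟩
  · exact ⟨_, _, polySubPath Dd.δ w i₀ k, h1, h2, hrange, hne, hze⟩
  · refine ⟨_, _, (polySubPath Dd.δ w i₀ k).symm, h2, h1, by rw [Path.symm_range]; exact hrange,
      fun m hm1 hm2 ↦ ?_, fun m hm hm' ↦ ?_⟩
    · rw [Path.crossInc_symm _ (hoff m).1 (hoff m).2]
      exact neg_ne_zero.2 (hne m hm1 hm2)
    · rw [Path.crossInc_symm _ (hoff m).1 (hoff m).2, hze m hm hm', neg_zero]

/-! ### Distinct side pairs -/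

/-- **Distinct side pairs.** In the open annulus `𝔸 = B(x, r₂) ∖ B̄(x, r₁)` minus the trace,
consider the components of the left and right points of two steps `mₐ`, `m_b` whose side
segments lie in `𝔸`. If there are two stretches of the path, over `I_b = [i_b, i_b + k_b] ∋ m_b`
and over `I_c = [i_c, i_c + k_c]`, each joining the inner disc to the outside of `𝔸`, with
`mₐ ∉ I_b ∪ I_c` and `m_b ∉ I_c`, then the unordered pairs of side components of `mₐ` and of
`m_b` differ. Proof: close the two stretches into a loop through the inside and the outside;
its crossing defect relative to the side segment of `m_b` is `±2πi`, relative to that of `mₐ`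
it is `0`; conclude with `sidePairs_ne_of_wind` (winding numbers are constant on components).
(Aizenman–Burchard 1999, App. A, "sectors" — by crossing parity, without the Jordan curve
theorem; triangular twin of `IsMedialExploration.sidePair_ne`.) [cite: AizenmanBurchardDuke1999, Appendix A] -/
theorem _root_.Literature.Probability.LatticeModels.IsExplorationPath.sidePair_ne (hδ : 0 < Dd.δ) {x : ℂ} {r₁ r₂ : ℝ} (hr₁ : 0 < r₁) (hr₁₂ : r₁ < r₂)
    {ma mb ib kb ic kc : ℕ} (hma : ma < w.length) (hb : ib + kb < w.length) (hc : ic + kc < w.length)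
    (hmb : ib ≤ mb ∧ mb ≤ ib + kb) (hma_b : ma < ib ∨ ib + kb < ma) (hma_c : ma < ic ∨ ic + kc < ma)
    (hmb_c : mb < ic ∨ ic + kc < mb)
    (hSa : hw.sideSeg ma ⊆ ball x r₂ \ closedBall x r₁)
    (hSb : hw.sideSeg mb ⊆ ball x r₂ \ closedBall x r₁)
    (hb_ends : (dist (polyPt Dd.δ w ib) x ≤ r₁ ∧ r₂ ≤ dist (polyPt Dd.δ w (ib + kb + 1)) x) ∨
      (r₂ ≤ dist (polyPt Dd.δ w ib) x ∧ dist (polyPt Dd.δ w (ib + kb + 1)) x ≤ r₁))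
    (hc_ends : (dist (polyPt Dd.δ w ic) x ≤ r₁ ∧ r₂ ≤ dist (polyPt Dd.δ w (ic + kc + 1)) x) ∨
      (r₂ ≤ dist (polyPt Dd.δ w ic) x ∧ dist (polyPt Dd.δ w (ic + kc + 1)) x ≤ r₁)) :
    s(connectedComponentIn ((ball x r₂ \ closedBall x r₁) \ polyTrace Dd.δ w) (hw.leftPt ma),
        connectedComponentIn ((ball x r₂ \ closedBall x r₁) \ polyTrace Dd.δ w) (hw.rightPt ma)) ≠
      s(connectedComponentIn ((ball x r₂ \ closedBall x r₁) \ polyTrace Dd.δ w) (hw.leftPt mb),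
        connectedComponentIn ((ball x r₂ \ closedBall x r₁) \ polyTrace Dd.δ w) (hw.rightPt mb)) := by
  have hr₂ : 0 < r₂ := hr₁.trans hr₁₂
  have hmb' : mb < w.length := by omega
  set X := (ball x r₂ \ closedBall x r₁) \ polyTrace Dd.δ w with hX
  -- the two stretches
  obtain ⟨Pin, Pout, κ, hPin, hPout, hκ, hκne, hκze⟩ := hw.exists_inout_path hδ hb hb_ends
  obtain ⟨Pin', Pout', κ', hPin', hPout', hκ', -, hκze'⟩ := hw.exists_inout_path hδ hc hc_ends
  -- the connectors
  obtain ⟨γo, hγo⟩ := IsMedialExploration.exists_path_outside hr₂ hPout hPout'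
  obtain ⟨γi, hγi⟩ := IsMedialExploration.exists_path_inside hPin' hPin
  set loop : Path Pin Pin := κ.trans (γo.trans (κ'.symm.trans γi)) with hloop
  -- points of the side segments: in the annulus, off the trace, off the connectors
  have hside : ∀ {m}, hw.sideSeg m ⊆ ball x r₂ \ closedBall x r₁ → ∀ q ∈ hw.sideSeg m,
      (∀ t, γo t ≠ q) ∧ (∀ t, γi t ≠ q) := by
    intro m hS q hq
    obtain ⟨hq1, hq2⟩ := hS hq
    rw [mem_ball] at hq1
    rw [mem_closedBall, not_le] at hq2
    exact ⟨fun t h ↦ by have := hγo t; rw [h] at this; linarith,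
      fun t h ↦ by have := hγi t; rw [h] at this; linarith⟩
  -- crossing defect of the loop relative to a side segment in the annulus
  have hcross : ∀ {m}, hw.sideSeg m ⊆ ball x r₂ \ closedBall x r₁ →
      loop.crossInc (hw.leftPt m) (hw.rightPt m) =
        κ.crossInc (hw.leftPt m) (hw.rightPt m) - κ'.crossInc (hw.leftPt m) (hw.rightPt m) := by
    intro m hS
    have hL : hw.leftPt m ∈ hw.sideSeg m := left_mem_segment _ _ _
    have hR : hw.rightPt m ∈ hw.sideSeg m := right_mem_segment _ _ _
    have hLt := hw.leftPt_not_mem_polyTrace hδ m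
    have hRt := hw.rightPt_not_mem_polyTrace hδ m
    obtain ⟨hLo, hLi⟩ := hside hS _ hL
    obtain ⟨hRo, hRi⟩ := hside hS _ hR
    have hLκ : hw.leftPt m ∉ range κ := fun h ↦ hLt (hκ h)
    have hRκ : hw.rightPt m ∉ range κ := fun h ↦ hRt (hκ h)
    have hLκ' : hw.leftPt m ∉ range κ'.symm := fun h ↦ hLt (hκ' (by rwa [Path.symm_range] at h))
    have hRκ' : hw.rightPt m ∉ range κ'.symm := fun h ↦ hRt (hκ' (by rwa [Path.symm_range] at h))
    have hLo' : hw.leftPt m ∉ range γo := by rintro ⟨t, ht⟩; exact hLo t ht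
    have hRo' : hw.rightPt m ∉ range γo := by rintro ⟨t, ht⟩; exact hRo t ht
    have hLi' : hw.leftPt m ∉ range γi := by rintro ⟨t, ht⟩; exact hLi t ht
    have hRi' : hw.rightPt m ∉ range γi := by rintro ⟨t, ht⟩; exact hRi t ht
    rw [hloop, Path.crossInc_trans _ _ hLκ (by
        rw [Path.trans_range, Path.trans_range]
        rintro (h | h | h); exacts [hLo' h, hLκ' h, hLi' h]) hRκ (by
        rw [Path.trans_range, Path.trans_range]
        rintro (h | h | h); exacts [hRo' h, hRκ' h, hRi' h]),
      Path.crossInc_trans _ _ hLo' (by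
        rw [Path.trans_range]
        rintro (h | h); exacts [hLκ' h, hLi' h]) hRo' (by
        rw [Path.trans_range]
        rintro (h | h); exacts [hRκ' h, hRi' h]),
      Path.crossInc_trans _ _ hLκ' hLi' hRκ' hRi',
      Path.crossInc_symm _ (fun h ↦ hLt (hκ' h)) (fun h ↦ hRt (hκ' h))]
    rw [Path.crossInc_eq_zero γo (fun t ht ↦ (hside hS _ ht).1 t rfl),
      Path.crossInc_eq_zero γi (fun t ht ↦ (hside hS _ ht).2 t rfl)]
    ring
  -- the side points are off the loop
  have hnotloop : ∀ {m}, hw.sideSeg m ⊆ ball x r₂ \ closedBall x r₁ →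
      hw.leftPt m ∉ range loop ∧ hw.rightPt m ∉ range loop := by
    intro m hS
    have aux : ∀ q ∈ hw.sideSeg m, q ∉ polyTrace Dd.δ w → q ∉ range loop := by
      intro q hq hqt h
      rw [hloop, Path.trans_range, Path.trans_range, Path.trans_range, Path.symm_range] at h
      rcases h with h | h | h | h
      · exact hqt (hκ h)
      · obtain ⟨t, ht⟩ := h; exact (hside hS q hq).1 t ht
      · exact hqt (hκ' h)
      · obtain ⟨t, ht⟩ := h; exact (hside hS q hq).2 t ht
    exact ⟨aux _ (left_mem_segment _ _ _) (hw.leftPt_not_mem_polyTrace hδ m),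
      aux _ (right_mem_segment _ _ _) (hw.rightPt_not_mem_polyTrace hδ m)⟩
  -- winding numbers
  have hwb : wind (fun t ↦ loop.extend t - hw.leftPt mb) ≠ wind (fun t ↦ loop.extend t - hw.rightPt mb) := by
    intro h
    have := Path.crossInc_loop loop (hnotloop hSb).1 (hnotloop hSb).2
    rw [h, sub_self, zero_mul, hcross hSb, hκze' mb hmb' hmb_c, sub_zero] at this
    exact hκne mb hmb.1 hmb.2 this
  have hwa : wind (fun t ↦ loop.extend t - hw.leftPt ma) = wind (fun t ↦ loop.extend t - hw.rightPt ma) := by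
    have := Path.crossInc_loop loop (hnotloop hSa).1 (hnotloop hSa).2
    rw [hcross hSa, hκze ma hma hma_b, hκze' ma hma hma_c, sub_self] at this
    have hpi : (2 * Real.pi * Complex.I : ℂ) ≠ 0 := by simp [Real.pi_ne_zero, Complex.I_ne_zero]
    have h0 := (mul_eq_zero.1 this.symm).resolve_right hpi
    have h1 : ((wind fun t ↦ loop.extend t - hw.leftPt ma : ℤ) : ℂ) =
        (wind fun t ↦ loop.extend t - hw.rightPt ma : ℤ) := by
      rw [sub_eq_zero] at h0; exact_mod_cast h0
    exact_mod_cast h1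
  -- the component bookkeeping
  have hK : IsClosed (range loop) := (isCompact_range loop.continuous).isClosed
  have hXK : X ⊆ (range loop)ᶜ := by
    intro z hz hzl
    obtain ⟨⟨hz1, hz2⟩, hzt⟩ := hz
    rw [mem_ball] at hz1
    rw [mem_closedBall, not_le] at hz2
    rw [hloop, Path.trans_range, Path.trans_range, Path.trans_range, Path.symm_range] at hzl
    rcases hzl with h | ⟨t, rfl⟩ | h | ⟨t, rfl⟩
    · exact hzt (hκ h)
    · linarith [hγo t]
    · exact hzt (hκ' h)
    · linarith [hγi t]
  have hℓa : hw.leftPt ma ∈ X := ⟨hSa (left_mem_segment _ _ _), hw.leftPt_not_mem_polyTrace hδ ma⟩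
  have hra : hw.rightPt ma ∈ X := ⟨hSa (right_mem_segment _ _ _), hw.rightPt_not_mem_polyTrace hδ ma⟩
  obtain ⟨h1, h2⟩ := sidePairs_ne_of_wind loop hK subset_rfl hXK hℓa hra hwa hwb
  intro h
  rw [Sym2.eq_iff] at h
  rcases h with ⟨h3, h4⟩ | ⟨h3, h4⟩
  · exact h1 ⟨h3, h4⟩
  · exact h2 ⟨h3, h4⟩

end SidePoints

end Literature.Probability.Percolation
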